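import Summits.QuantumAdvantage.QuantumAdvantage.Theorems.HolonomyDialFibre

/-!
# HolonomyDial — Chain (cell decomp-qadv, seat lens-2, generation 13; supports item 26531 `ExactnessDial.PolyLossOddU3`)

§H part 3: `step_two_sided`, the four-block chain `chain4`, sign bookkeeping (`θ`, `psgn_1…psgn_N`, `pat_of_odd`, `odd_of_pat`) and the pattern bound `pattern_bound`.

Split (≤ 400 lines, part 10/11) of the node file `HOME/decomp-qadv-lens-2/g13/HolonomyDial.lean` (v5, sha256 fb2c0281…,
farm rc 0, no placeholders); declarations verbatim, namespace `Summit.QuantumAdvantage.QuantumAdvantage.Theorems.HolonomyDial`.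
Record: NODE-g13.md.
-/

set_option linter.dupNamespace false

noncomputable section
open scoped Classical

namespace Summit.QuantumAdvantage.QuantumAdvantage.Theorems

open Finset
open Literature.Computability.QuantumComplexity Literature.Computability.QuantumComplexity.RingHLF
open Literature.Computability.MetaComplexity Literature.Computability.MetaComplexity.Smolensky
open Summit.QuantumAdvantage.AdviceFreeQNC0
open Summit.QuantumAdvantage.QuantumAdvantage.Theses (ExactnessDial.PolyLossOddU3 ExactnessDial.NoPerfectOdd3
  ExactnessDial.NoPerfectConst3 ExactnessDial.MassStep3u ExactnessDial.OddToAll3 ExactnessDial.DPLift3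
  ExactnessDial.MultiRingBridge3 ExactnessDial.closes)

namespace HolonomyDial

section AvoidHard

variable {N : ℕ}

section Fibre

/-- the two-sided form used in the chain: with `T = A + B`, `2KA ≤ KT + 2^N` and `KT ≤ 2KA + 2^N`. -/
theorem step_two_sided {s m D K : ℕ} (hsm : s + m ≤ N) (hm : Odd m) (hm3 : 3 ≤ m)
    (hK : K * ((D + D) * m.choose (m / 2)) ≤ 2 ^ m)
    {P : CubeFn (ZMod 3) N} (hP : P ∈ lowDeg (ZMod 3) N D)
    (R : (Fin N → Bool) → Prop) [DecidablePred R] (hR : ∀ ρ (w w' : Fin m → Bool), R (joinAt s m ρ w) → R (joinAt s m ρ w'))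
    (τ : ZMod 3) (hτ : τ = 1 ∨ τ = -1) :
    K * (2 * (univ.filter fun x => P x = 1 ∧ R x ∧ bsgn s m x = τ).card) ≤
      K * (univ.filter fun x => P x = 1 ∧ R x).card + 2 ^ N ∧
    K * (univ.filter fun x => P x = 1 ∧ R x).card ≤
      K * (2 * (univ.filter fun x => P x = 1 ∧ R x ∧ bsgn s m x = τ).card) + 2 ^ N := by
  have h1 := step_le hsm hm hm3 hK hP R hR τ hτ
  have h2 := step_le hsm hm hm3 hK hP R hR (-τ) (by rcases hτ with rfl | rfl <;> simp)
  rw [neg_neg] at h2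
  have hsplit : (univ.filter fun x => P x = 1 ∧ R x).card =
      (univ.filter fun x => P x = 1 ∧ R x ∧ bsgn s m x = τ).card +
        (univ.filter fun x => P x = 1 ∧ R x ∧ bsgn s m x = -τ).card := by
    rw [← Finset.card_union_of_disjoint (Finset.disjoint_filter.2 fun x _ ha hb => by
      rw [ha.2.2] at hb; rcases hτ with rfl | rfl <;> exact absurd hb.2.2 (by decide))]
    congr 1
    ext x
    rw [mem_union, mem_filter, mem_filter, mem_filter]
    constructor
    · rintro ⟨_, hp, hr⟩
      rcases bsgn_cases s m x with h | h
      · rcases hτ with rfl | rfl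
        · exact Or.inl ⟨mem_univ _, hp, hr, h⟩
        · exact Or.inr ⟨mem_univ _, hp, hr, by rw [h]; ring⟩
      · rcases hτ with rfl | rfl
        · exact Or.inr ⟨mem_univ _, hp, hr, h⟩
        · exact Or.inl ⟨mem_univ _, hp, hr, h⟩
    · rintro (⟨_, hp, hr, _⟩ | ⟨_, hp, hr, _⟩) <;> exact ⟨mem_univ _, hp, hr⟩
  rw [hsplit]
  constructor
  · have := h1; nlinarith [this]
  · nlinarith [h2]

end Fibre

/-! ### H6. the four-block chain, sign bookkeeping, and the pattern bound -/

section Chain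

/-- four halving steps: freeing the blocks `[0,m), [m,2m), [2m,3m), [3m,4m)` one after the other (tail sign fixed). -/
theorem chain4 {m D : ℕ} (h4m : 4 * m ≤ N) (hm : Odd m) (hm3 : 3 ≤ m)
    (hK : 512 * ((D + D) * m.choose (m / 2)) ≤ 2 ^ m)
    {P : CubeFn (ZMod 3) N} (hP : P ∈ lowDeg (ZMod 3) N D) (τt τ1 τ2 τ3 τ4 : ZMod 3)
    (hτ1 : τ1 = 1 ∨ τ1 = -1) (hτ2 : τ2 = 1 ∨ τ2 = -1) (hτ3 : τ3 = 1 ∨ τ3 = -1) (hτ4 : τ4 = 1 ∨ τ4 = -1) :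
    8192 * (univ.filter fun x => P x = 1 ∧ (((bsgn (4 * m) (N - 4 * m) x = τt ∧ bsgn 0 m x = τ1) ∧
        bsgn (1 * m) m x = τ2) ∧ bsgn (2 * m) m x = τ3) ∧ bsgn (3 * m) m x = τ4).card
      ≤ 512 * (univ.filter fun x => P x = 1 ∧ bsgn (4 * m) (N - 4 * m) x = τt).card + 15 * 2 ^ N ∧
    512 * (univ.filter fun x => P x = 1 ∧ bsgn (4 * m) (N - 4 * m) x = τt).card ≤
      8192 * (univ.filter fun x => P x = 1 ∧ (((bsgn (4 * m) (N - 4 * m) x = τt ∧ bsgn 0 m x = τ1) ∧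
        bsgn (1 * m) m x = τ2) ∧ bsgn (2 * m) m x = τ3) ∧ bsgn (3 * m) m x = τ4).card + 15 * 2 ^ N := by
  obtain ⟨a1, b1⟩ := step_two_sided (N := N) (s := 0) (m := m) (K := 512) (by omega) hm hm3 hK hP
    (fun x => bsgn (4 * m) (N - 4 * m) x = τt)
    (fun ρ w w' h => by
      rw [bsgn_joinAt_of_disjoint (s := 0) (m := m) (s' := 4 * m) (m' := N - 4 * m) (Or.inr (by omega))] at h ⊢
      exact h) τ1 hτ1
  obtain ⟨a2, b2⟩ := step_two_sided (N := N) (s := 1 * m) (m := m) (K := 512) (by omega) hm hm3 hK hP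
    (fun x => bsgn (4 * m) (N - 4 * m) x = τt ∧ bsgn 0 m x = τ1)
    (fun ρ w w' h => by
      rw [bsgn_joinAt_of_disjoint (s := 1 * m) (m := m) (s' := 4 * m) (m' := N - 4 * m) (Or.inr (by omega)),
        bsgn_joinAt_of_disjoint (s := 1 * m) (m := m) (s' := 0) (m' := m) (Or.inl (by omega))] at h ⊢
      exact h) τ2 hτ2
  obtain ⟨a3, b3⟩ := step_two_sided (N := N) (s := 2 * m) (m := m) (K := 512) (by omega) hm hm3 hK hP
    (fun x => (bsgn (4 * m) (N - 4 * m) x = τt ∧ bsgn 0 m x = τ1) ∧ bsgn (1 * m) m x = τ2)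
    (fun ρ w w' h => by
      rw [bsgn_joinAt_of_disjoint (s := 2 * m) (m := m) (s' := 4 * m) (m' := N - 4 * m) (Or.inr (by omega)),
        bsgn_joinAt_of_disjoint (s := 2 * m) (m := m) (s' := 0) (m' := m) (Or.inl (by omega)),
        bsgn_joinAt_of_disjoint (s := 2 * m) (m := m) (s' := 1 * m) (m' := m) (Or.inl (by omega))] at h ⊢
      exact h) τ3 hτ3
  obtain ⟨a4, b4⟩ := step_two_sided (N := N) (s := 3 * m) (m := m) (K := 512) (by omega) hm hm3 hK hP
    (fun x => ((bsgn (4 * m) (N - 4 * m) x = τt ∧ bsgn 0 m x = τ1) ∧ bsgn (1 * m) m x = τ2) ∧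
      bsgn (2 * m) m x = τ3)
    (fun ρ w w' h => by
      rw [bsgn_joinAt_of_disjoint (s := 3 * m) (m := m) (s' := 4 * m) (m' := N - 4 * m) (Or.inr (by omega)),
        bsgn_joinAt_of_disjoint (s := 3 * m) (m := m) (s' := 0) (m' := m) (Or.inl (by omega)),
        bsgn_joinAt_of_disjoint (s := 3 * m) (m := m) (s' := 1 * m) (m' := m) (Or.inl (by omega)),
        bsgn_joinAt_of_disjoint (s := 3 * m) (m := m) (s' := 2 * m) (m' := m) (Or.inl (by omega))] at h ⊢
      exact h) τ4 hτ4
  constructor <;> omega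

/-- sign of a bit. -/
def θ (b : Bool) : ZMod 3 := if b then -1 else 1

/-- HolonomyDial helper `θ_cases` (lens-2 g13 package; see the module docstring). -/
theorem θ_cases (b : Bool) : θ b = 1 ∨ θ b = -1 := by cases b <;> decide

/-- HolonomyDial helper `θ_inj` (lens-2 g13 package; see the module docstring). -/
theorem θ_inj {a b : Bool} (h : θ a = θ b) : a = b := by revert h; cases a <;> cases b <;> decide

/-- Ring-game helper `sgn_solve` (lens-2 law package; see the module docstring). -/
theorem sgn_solve : ∀ a b c : ZMod 3, (a = 1 ∨ a = -1) → c = a * b → b = a * c := by decide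
/-- Ring-game helper `sgn_solve'` (lens-2 law package; see the module docstring). -/
theorem sgn_solve' : ∀ a b t : ZMod 3, (a = 1 ∨ a = -1) → (b = 1 ∨ b = -1) → (t = 1 ∨ t = -1) →
    -1 = a * b * t → b = -(a * t) := by decide
/-- Ring-game helper `sgn_eval` (lens-2 law package; see the module docstring). -/
theorem sgn_eval : ∀ a t : ZMod 3, (a = 1 ∨ a = -1) → (t = 1 ∨ t = -1) → a * -(a * t) * t = -1 := by decide
/-- Ring-game helper `sgn_eval'` (lens-2 law package; see the module docstring). -/
theorem sgn_eval' : ∀ a b : ZMod 3, (a = 1 ∨ a = -1) → a * (a * b) = b := by decide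
/-- Ring-game helper `sgn_mul` (lens-2 law package; see the module docstring). -/
theorem sgn_mul : ∀ a b : ZMod 3, (a = 1 ∨ a = -1) → (b = 1 ∨ b = -1) → (a * b = 1 ∨ a * b = -1) := by decide
/-- Ring-game helper `sgn_neg` (lens-2 law package; see the module docstring). -/
theorem sgn_neg : ∀ a : ZMod 3, (a = 1 ∨ a = -1) → (-a = 1 ∨ -a = -1) := by decide

/-- Ring-game helper `psgn_1` (lens-2 law package; see the module docstring). -/
theorem psgn_1 (x : Fin N → Bool) (m : ℕ) : psgn x (1 * m) = bsgn 0 m x := by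
  rw [show 1 * m = 0 + m by ring, psgn_add, psgn_zero, one_mul]
/-- Ring-game helper `psgn_2` (lens-2 law package; see the module docstring). -/
theorem psgn_2 (x : Fin N → Bool) (m : ℕ) : psgn x (2 * m) = psgn x (1 * m) * bsgn (1 * m) m x := by
  rw [show 2 * m = 1 * m + m by ring, psgn_add]
/-- Ring-game helper `psgn_3` (lens-2 law package; see the module docstring). -/
theorem psgn_3 (x : Fin N → Bool) (m : ℕ) : psgn x (3 * m) = psgn x (2 * m) * bsgn (2 * m) m x := by
  rw [show 3 * m = 2 * m + m by ring, psgn_add]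
/-- Ring-game helper `psgn_4` (lens-2 law package; see the module docstring). -/
theorem psgn_4 (x : Fin N → Bool) (m : ℕ) : psgn x (4 * m) = psgn x (3 * m) * bsgn (3 * m) m x := by
  rw [show 4 * m = 3 * m + m by ring, psgn_add]
/-- Ring-game helper `psgn_N` (lens-2 law package; see the module docstring). -/
theorem psgn_N {m : ℕ} (h4m : 4 * m ≤ N) (x : Fin N → Bool) :
    psgn x N = psgn x (4 * m) * bsgn (4 * m) (N - 4 * m) x := by
  have := psgn_add x (4 * m) (N - 4 * m)
  rwa [show 4 * m + (N - 4 * m) = N by omega] at this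

/-- on the odd class the block signs are read off the pattern `(z₁, z₂, z₃)` and the tail sign. -/
theorem pat_of_odd {m : ℕ} (h4m : 4 * m ≤ N) (x : Fin N → Bool) (hodd : OddZeros x) :
    bsgn 0 m x = θ (zb m 1 x) ∧ bsgn (1 * m) m x = θ (zb m 1 x) * θ (zb m 2 x) ∧
    bsgn (2 * m) m x = θ (zb m 2 x) * θ (zb m 3 x) ∧
    bsgn (3 * m) m x = -(θ (zb m 3 x) * bsgn (4 * m) (N - 4 * m) x) := by
  have e1 := psgn_1 x m
  have e2 := psgn_2 x m
  have e3 := psgn_3 x m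
  have e4 := psgn_4 x m
  have eN := psgn_N h4m x
  rw [(oddZeros_iff_psgn x).1 hodd] at eN
  have z1 : psgn x (1 * m) = θ (zb m 1 x) := rfl
  have z2 : psgn x (2 * m) = θ (zb m 2 x) := rfl
  have z3 : psgn x (3 * m) = θ (zb m 3 x) := rfl
  refine ⟨?_, ?_, ?_, ?_⟩
  · rw [← e1, z1]
  · rw [z1, z2] at e2
    exact sgn_solve _ _ _ (θ_cases _) e2
  · rw [z2, z3] at e3
    exact sgn_solve _ _ _ (θ_cases _) e3
  · rw [e4, z3] at eN
    exact sgn_solve' _ _ _ (θ_cases _) (bsgn_cases _ _ x) (bsgn_cases _ _ x) eN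

/-- conversely a block-sign pattern of the right shape forces the odd class and the pattern. -/
theorem odd_of_pat {m : ℕ} (h4m : 4 * m ≤ N) (x : Fin N → Bool) (q : Bool × Bool × Bool) {τt : ZMod 3}
    (hτt : τt = 1 ∨ τt = -1) (ht : bsgn (4 * m) (N - 4 * m) x = τt) (hb0 : bsgn 0 m x = θ q.1)
    (hb1 : bsgn (1 * m) m x = θ q.1 * θ q.2.1) (hb2 : bsgn (2 * m) m x = θ q.2.1 * θ q.2.2)
    (hb3 : bsgn (3 * m) m x = -(θ q.2.2 * τt)) :
    OddZeros x ∧ (zb m 1 x, zb m 2 x, zb m 3 x) = q := by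
  have e1 := psgn_1 x m
  have e2 := psgn_2 x m
  have e3 := psgn_3 x m
  have e4 := psgn_4 x m
  have eN := psgn_N h4m x
  have p1 : psgn x (1 * m) = θ q.1 := by rw [e1, hb0]
  have p2 : psgn x (2 * m) = θ q.2.1 := by rw [e2, p1, hb1]; exact sgn_eval' _ _ (θ_cases _)
  have p3 : psgn x (3 * m) = θ q.2.2 := by rw [e3, p2, hb2]; exact sgn_eval' _ _ (θ_cases _)
  have pN : psgn x N = -1 := by rw [eN, e4, p3, hb3, ht]; exact sgn_eval _ _ (θ_cases _) hτt
  refine ⟨(oddZeros_iff_psgn x).2 pN, ?_⟩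
  have q1 : zb m 1 x = q.1 := θ_inj (show θ (zb m 1 x) = θ q.1 from p1)
  have q2 : zb m 2 x = q.2.1 := θ_inj (show θ (zb m 2 x) = θ q.2.1 from p2)
  have q3 : zb m 3 x = q.2.2 := θ_inj (show θ (zb m 3 x) = θ q.2.2 from p3)
  exact Prod.ext q1 (Prod.ext q2 q3)

variable (m : ℕ) (L : CubeFn (ZMod 3) N)

/-- **pattern bound**: for a fixed event `q ∈ A(data x)` and tail sign, `4096·N_q(τt) ≤ 512·|E_q ∩ odd ∩ tail| + 15·2^N`. -/
theorem pattern_bound {D : ℕ} (h4m : 4 * m ≤ N) (hm : Odd m) (hm3 : 3 ≤ m)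
    (hK : 512 * ((8 * D + 8 * D) * m.choose (m / 2)) ≤ 2 ^ m)
    (hL : L ∈ lowDeg (ZMod 3) N D) (q : Bool × Bool × Bool) (τt : ZMod 3) (hτt : τt = 1 ∨ τt = -1) :
    4096 * (univ.filter fun x : Fin N → Bool => OddZeros x ∧ q ∈ compatSet (dat m L x) ∧
        (zb m 1 x, zb m 2 x, zb m 3 x) = q ∧ bsgn (4 * m) (N - 4 * m) x = τt).card ≤
      512 * (univ.filter fun x : Fin N → Bool =>
        eInd m L q x = 1 ∧ bsgn (4 * m) (N - 4 * m) x = τt ∧ OddZeros x).card + 15 * 2 ^ N := by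
  have hP := eInd_mem (m := m) (L := L) hL q
  have hch := fun q' : Bool × Bool × Bool =>
    chain4 h4m hm hm3 hK hP τt (θ q'.1) (θ q'.1 * θ q'.2.1) (θ q'.2.1 * θ q'.2.2) (-(θ q'.2.2 * τt))
      (θ_cases _) (sgn_mul _ _ (θ_cases _) (θ_cases _)) (sgn_mul _ _ (θ_cases _) (θ_cases _))
      (sgn_neg _ (sgn_mul _ _ (θ_cases _) hτt))
  -- (3) the eight pattern sets are disjoint subsets of `E ∩ tail ∩ odd`
  have hdisj : ∀ q' ∈ (univ : Finset (Bool × Bool × Bool)), ∀ q'' ∈ (univ : Finset (Bool × Bool × Bool)), q' ≠ q'' →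
      Disjoint
        (univ.filter fun x : Fin N → Bool => eInd m L q x = 1 ∧
          (((bsgn (4 * m) (N - 4 * m) x = τt ∧ bsgn 0 m x = θ q'.1) ∧ bsgn (1 * m) m x = θ q'.1 * θ q'.2.1) ∧
            bsgn (2 * m) m x = θ q'.2.1 * θ q'.2.2) ∧ bsgn (3 * m) m x = -(θ q'.2.2 * τt))
        (univ.filter fun x : Fin N → Bool => eInd m L q x = 1 ∧
          (((bsgn (4 * m) (N - 4 * m) x = τt ∧ bsgn 0 m x = θ q''.1) ∧ bsgn (1 * m) m x = θ q''.1 * θ q''.2.1) ∧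
            bsgn (2 * m) m x = θ q''.2.1 * θ q''.2.2) ∧ bsgn (3 * m) m x = -(θ q''.2.2 * τt)) := by
    intro q' _ q'' _ hne
    rw [Finset.disjoint_left]
    intro x h' h''
    rw [mem_filter] at h' h''
    obtain ⟨_, _, ⟨⟨⟨ht, hb0⟩, hb1⟩, hb2⟩, hb3⟩ := h'
    obtain ⟨_, _, ⟨⟨⟨_, hb0'⟩, hb1'⟩, hb2'⟩, hb3'⟩ := h''
    have e' := (odd_of_pat h4m x q' hτt ht hb0 hb1 hb2 hb3).2
    have e'' := (odd_of_pat h4m x q'' hτt ht hb0' hb1' hb2' hb3').2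
    exact hne (e'.symm.trans e'')
  have hU := Finset.card_biUnion hdisj
  have hsub : (univ : Finset (Bool × Bool × Bool)).biUnion (fun q' =>
        univ.filter fun x : Fin N → Bool => eInd m L q x = 1 ∧
          (((bsgn (4 * m) (N - 4 * m) x = τt ∧ bsgn 0 m x = θ q'.1) ∧ bsgn (1 * m) m x = θ q'.1 * θ q'.2.1) ∧
            bsgn (2 * m) m x = θ q'.2.1 * θ q'.2.2) ∧ bsgn (3 * m) m x = -(θ q'.2.2 * τt)) ⊆
      univ.filter fun x : Fin N → Bool => eInd m L q x = 1 ∧ bsgn (4 * m) (N - 4 * m) x = τt ∧ OddZeros x := by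
    intro x hx
    rw [Finset.mem_biUnion] at hx
    obtain ⟨q', _, hx⟩ := hx
    rw [mem_filter] at hx ⊢
    obtain ⟨_, hP1, ⟨⟨⟨ht, hb0⟩, hb1⟩, hb2⟩, hb3⟩ := hx
    exact ⟨mem_univ _, hP1, ht, (odd_of_pat h4m x q' hτt ht hb0 hb1 hb2 hb3).1⟩
  have h3 := card_le_card hsub
  rw [hU] at h3
  -- (4) the `q`-pattern set contains `N_q(τt)`
  have h4 : (univ.filter fun x : Fin N → Bool => OddZeros x ∧ q ∈ compatSet (dat m L x) ∧
        (zb m 1 x, zb m 2 x, zb m 3 x) = q ∧ bsgn (4 * m) (N - 4 * m) x = τt).card ≤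
      (univ.filter fun x : Fin N → Bool => eInd m L q x = 1 ∧
          (((bsgn (4 * m) (N - 4 * m) x = τt ∧ bsgn 0 m x = θ q.1) ∧ bsgn (1 * m) m x = θ q.1 * θ q.2.1) ∧
            bsgn (2 * m) m x = θ q.2.1 * θ q.2.2) ∧ bsgn (3 * m) m x = -(θ q.2.2 * τt)).card := by
    refine card_le_card fun x hx => ?_
    rw [mem_filter] at hx ⊢
    obtain ⟨_, hodd, hq, hz, ht⟩ := hx
    obtain ⟨p0, p1, p2, p3⟩ := pat_of_odd h4m x hodd
    have hz1 : zb m 1 x = q.1 := congrArg Prod.fst hz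
    have hz2 : zb m 2 x = q.2.1 := congrArg (fun t => t.2.1) hz
    have hz3 : zb m 3 x = q.2.2 := congrArg (fun t => t.2.2) hz
    rw [hz1] at p0 p1
    rw [hz2] at p1 p2
    rw [hz3, ht] at p3
    rw [hz3] at p2
    refine ⟨mem_univ _, ?_, ⟨⟨⟨ht, p0⟩, p1⟩, p2⟩, p3⟩
    rw [eInd_apply, if_pos hq]
  -- (5) sum the lower chain bounds over the eight patterns
  have h5 := Finset.sum_le_sum fun q' (_ : q' ∈ (univ : Finset (Bool × Bool × Bool))) => (hch q').2
  simp only [Finset.sum_const, Finset.card_univ, Fintype.card_prod, Fintype.card_bool, smul_eq_mul,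
    Finset.sum_add_distrib, ← Finset.mul_sum] at h5
  have h2 := (hch q).1
  omega

end Chain
end AvoidHard

end HolonomyDial

end Summit.QuantumAdvantage.QuantumAdvantage.Theorems
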